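import Summits.CriticalPhenomena.CardyFormulaZ2.Theses.CardyComplexCone
import Summits.CriticalPhenomena.CardyFormulaZ2.Theorems.CardySusyWardParafermionPrecompactFourClassTransferCore
import Summits.CriticalPhenomena.CardyFormulaZ2.Theorems.ParafermionPrecompact.Negative.ParafermionPrecompactFalseOfBulkNondegenerate
import Literature.Probability.LatticeModels.MedialWindingBridge

/-!
# `EdgePrecompact` (stmt-11387) ⇒ the repaired crux `C′` of stmt-11293, BY NAME

Line `four-class-vertex-transfer` of the crux `ParafermionPrecompact` (route `CardySusyWard`, item
stmt-CriticalPhenomena-11293), lead `prover-line-stmt-CriticalPhenomena-11293-c1-0`: the by-name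
corollary of the route-free per-domain transfer `repairedClauses_of_classBounds`
(`…FourClassTransferCore`). The `let`-bound integrand of `CardyComplexCone.EdgePrecompact` is the named
dart phase sum (`edgeIntegrand_eq_dartPhaseSum`), so `EdgePrecompact` reads over `bondDartObservable`
(`edgePrecompact_bondDartObservable`); restricted to the class corners `(w, w + c_q)` (every corner is
one, and all of them have class `c_q`) it is exactly the pair of hypotheses (a), (b) of the transfer,
whence `repairedAt_of_edgePrecompact : EdgePrecompact → ∀ D Λ, C′(D, Λ)` (registered sub-goal of the item) —
the repaired 11293 is a corollary of 11387 (honest label: 11387 is the logically stronger statement).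
References: S. Smirnov, Ann. of Math. 172 (2010), §2.2 [Smirnov2010]; H. Duminil-Copin, S. Smirnov,
Clay Math. Proc. 15 (2012), §8.3 [DuminilCopinSmirnov2012Lattice].
-/

noncomputable section

namespace Summit.CriticalPhenomena.CardyFormulaZ2.Cruxes.ParafermionPrecompact.FourClassVertexTransfer

open scoped BigOperators Topology
open Filter Set MeasureTheory
open _root_.Literature.Probability.LatticeModels
open _root_.Literature.Probability.RandomPlanarGeometry (DobrushinDomain)
open _root_.Literature.Probability.Percolation (BondConfig bondPercolation half)
open Summit.CriticalPhenomena.CardyFormulaZ2.Theorems.ParafermionPrecompact.Negative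
  (IsFamily ParafermionPrecompactRepairedAt)
open Summit.CriticalPhenomena.CardyFormulaZ2.Theses.CardyComplexCone (EdgePrecompact)
open KenyonStreamSecondRelation (classOffset classComp dartField isCorner_iff_classOffset)
-- buildfix lane 2026-08-20: the route decl `EdgePrecompact` names FermionicObservable's `LatticeModels.winding`
-- while `Parafermion.dartPhaseSum` unfolds to the copy `Polyline.winding`; both are in the cone now, so the
-- short name is ambiguous. Namespace-local alias to the OLD constant (exact name; as in the accepted build and
-- in the route file); the two copies are bridged by `Polyline.winding_eq_winding` where a proof needs it.
export _root_.Literature.Probability.LatticeModels (winding)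

/-- The `let`-bound integrand of `CardyComplexCone.EdgePrecompact` at `(δ, v, f)` is the named dart
phase sum `dartPhaseSum γ δ (1/3) (v, f)` of `DartPhase.lean` (only the spelling `-(i/3)·W` versus
`-i·(1/3)·W` of the exponent differs). [folklore] -/
theorem edgeIntegrand_eq_dartPhaseSum (γ : List MedialVertex) (δ : ℝ) (v f : Site 2) :
    (∑ k ∈ (Finset.range γ.length).filter (fun k => γ[k]? = some (cornerSource v f) ∧
        γ[k + 1]? = some (cornerTarget v f)),
        Complex.exp (-(Complex.I / 3) * ((winding ((γ.map (medialPoint δ)).take (k + 2)) : ℝ) : ℂ))) =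
      Parafermion.dartPhaseSum γ δ (1 / 3) (v, f) := by
  unfold Parafermion.dartPhaseSum
  refine Finset.sum_congr rfl fun k _ => ?_
  rw [← Literature.Probability.LatticeModels.Polyline.winding_eq_winding] -- buildfix: align the two copies
  congr 1
  push_cast
  ring

/-- Integrated form: the corner observable of `EdgePrecompact` for the datum `E` at mesh `δ` is
`bondDartObservable E δ (1/3) (v, f)`. [folklore] -/
theorem integral_edgeIntegrand (E : DiscreteDobrushin) (δ : ℝ) (v f : Site 2) :
    (∫ ω, (let γ := medialExploration E ω;
        ∑ k ∈ (Finset.range γ.length).filter (fun k => γ[k]? = some (cornerSource v f) ∧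
            γ[k + 1]? = some (cornerTarget v f)),
          Complex.exp (-(Complex.I / 3) *
            ((winding ((γ.map (medialPoint δ)).take (k + 2)) : ℝ) : ℂ)))
        ∂(bondPercolation (zdGraph 2) half)) =
      bondDartObservable E δ (1 / 3) (v, f) := by
  rw [Parafermion.bondDartObservable_def]
  exact integral_congr_ae (ae_of_all _ fun ω => edgeIntegrand_eq_dartPhaseSum _ δ v f)

/-- **Bridge to the twin crux.** `EdgePrecompact` read over `bondDartObservable (Λ δ) δ (1/3)`:
per-corner bound (i) and same-class equicontinuity (ii) on a compact `K ⊆ Ω`, for a family with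
`Ω = D`, mesh `δ`, eventually admissible. [folklore] -/
theorem edgePrecompact_bondDartObservable (hEP : EdgePrecompact) (D : DobrushinDomain)
    (Λ : ℝ → DiscreteDobrushin) (hΩ : ∀ δ, (Λ δ).Ω = D.carrier) (hδ : ∀ δ, (Λ δ).δ = δ)
    (hadm : ∀ᶠ δ in 𝓝[>] (0:ℝ), (Λ δ).IsZdAdmissible) (K : Set ℂ) (hK : IsCompact K)
    (hKD : K ⊆ D.carrier) :
    (∃ C : ℝ, ∀ᶠ δ in 𝓝[>] (0:ℝ), ∀ v f : Site 2, IsCorner v f → meshPoint δ v ∈ K →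
        ‖bondDartObservable (Λ δ) δ (1 / 3) (v, f)‖ ≤ C * δ ^ ((1:ℝ) / 3)) ∧
      (∀ ε > (0:ℝ), ∃ η > (0:ℝ), ∀ᶠ δ in 𝓝[>] (0:ℝ), ∀ v f v' f' : Site 2,
        IsCorner v f → IsCorner v' f' → f - v = f' - v' → meshPoint δ v ∈ K →
          meshPoint δ v' ∈ K → dist (meshPoint δ v) (meshPoint δ v') < η →
            ‖bondDartObservable (Λ δ) δ (1 / 3) (v, f) - bondDartObservable (Λ δ) δ (1 / 3) (v', f')‖ ≤
              ε * δ ^ ((1:ℝ) / 3)) := by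
  have h := hEP D Λ hΩ hδ hadm K hK hKD
  simp only [integral_edgeIntegrand] at h
  exact h

/-- The class components of the dart field of `Λ δ` are the corner observables of `EdgePrecompact`
at the class corners `(w, w + c_q)` (mesh `(Λ δ).δ = δ`). [folklore] -/
theorem classComp_dartField_eq (Λ : ℝ → DiscreteDobrushin) {δ : ℝ} (hδ : (Λ δ).δ = δ)
    (q : Fin 4) (w : Site 2) :
    classComp (dartField (Λ δ)) q w = bondDartObservable (Λ δ) δ (1 / 3) (w, w + classOffset q) := by
  simp only [classComp, dartField, hδ]

/-- The class-`q` corner at a site is a corner, of class `c_q` independently of the site. [folklore] -/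
theorem isCorner_classCorner (w : Site 2) (q : Fin 4) : IsCorner w (w + classOffset q) :=
  (isCorner_iff_classOffset _ _).2 ⟨q, rfl⟩

/-- **`EdgePrecompact` ⇒ `C′(D, Λ)` for every `D, Λ`.** The twin crux `CardyComplexCone.EdgePrecompact`
(stmt-CriticalPhenomena-11387) implies the repaired crux `Negative.ParafermionPrecompactRepairedAt D Λ`
of stmt-CriticalPhenomena-11293 for every Dobrushin domain `D` and every `Λ` (the family hypotheses are
part of `C′`): restrict `EdgePrecompact` to the class corners and apply the per-domain transfer. [folklore] -/
theorem repairedAt_of_edgePrecompact :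
    Summit.CriticalPhenomena.CardyFormulaZ2.Theses.CardyComplexCone.EdgePrecompact → ∀ (D : DobrushinDomain) (Λ : ℝ → DiscreteDobrushin), Summit.CriticalPhenomena.CardyFormulaZ2.Theorems.ParafermionPrecompact.Negative.ParafermionPrecompactRepairedAt D Λ := by
  intro hEP D Λ hfam
  have hΩ := hfam.1
  have hδ := hfam.2.1
  have hadm := hfam.2.2.2.2.2
  refine repairedClauses_of_classBounds D Λ hδ hfam.2.2.2.2.1 (fun K hK hKD => ?_)
    (fun K hK hKD ε hε => ?_)
  · obtain ⟨⟨C, hC⟩, -⟩ := edgePrecompact_bondDartObservable hEP D Λ hΩ hδ hadm K hK hKD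
    refine ⟨C, ?_⟩
    filter_upwards [hC] with δ' hCδ q w hw
    rw [classComp_dartField_eq Λ (hδ δ')]
    exact hCδ _ _ (isCorner_classCorner w q) hw
  · obtain ⟨-, hii⟩ := edgePrecompact_bondDartObservable hEP D Λ hΩ hδ hadm K hK hKD
    obtain ⟨η, hη, hev⟩ := hii ε hε
    refine ⟨η, hη, ?_⟩
    filter_upwards [hev] with δ' hevδ q w w' hw hw' hd
    rw [classComp_dartField_eq Λ (hδ δ'), classComp_dartField_eq Λ (hδ δ')]
    exact hevδ _ _ _ _ (isCorner_classCorner w q) (isCorner_classCorner w' q)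
      (by simp only [add_sub_cancel_left]) hw hw' hd

/-- Uncurried spelling (`EdgePrecompact → C′(D, Λ)` for given `D, Λ`): the repaired crux of
stmt-CriticalPhenomena-11293 is a corollary of stmt-CriticalPhenomena-11387. [folklore] -/
theorem parafermionPrecompactRepairedAt_of_edgePrecompact (hEP : EdgePrecompact)
    (D : DobrushinDomain) (Λ : ℝ → DiscreteDobrushin) : ParafermionPrecompactRepairedAt D Λ :=
  repairedAt_of_edgePrecompact hEP D Λ

end Summit.CriticalPhenomena.CardyFormulaZ2.Cruxes.ParafermionPrecompact.FourClassVertexTransfer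

end
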